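import Literature.NumberTheory.EllipticCurves.PAdicHeightsK
import HarnessLib

/-!
# Delbourgo, J. Number Theory 95 (2002), p. 39: the NORMALISED Schneider height
# `⟨·,·⟩_{p,ℚ} := [K:ℚ]⁻¹ · ⟨·,·⟩^{Sch}_{p,K}` of a curve non-semistable at `p`, transported along an
# additive map of point groups — a DEFINITION (operation on height data), with its unfolding lemmas

HONEST FRAMING (BSD rank-`≤ 1` residual cell `b2b-bsdres`, home
`run/shared/lean/b2b/bsd-rank1-residual/`, unit `b2b-bsdres-cc-typer-2` GEN 3; n1011 lead R5-32 (c),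
route planner 3 sub-target (S8′)): the cell deletes the COMBINATION-SHAPED residual classes of the
rank-`≤ 1` BSD formula from PUBLISHED theorems only and TYPES the construction-shaped ones; this is
not "finishing BSD". THIS FILE IS A DEFINITION WITH A BODY and proved unfolding lemmas: NO named
fact, NO theorem of arithmetic, nothing asserted (D-0026: net debt 0).

## What and why

Delbourgo 2002, p. 39 (held copy `paper:delbourgo2002-p-adic-birch-swinnerton-dyer-conjecture-non`,
chunk p0002 L40–48, verbatim): "Since the theory of `p`-adic heights was developed for the semistable
ordinary case we take `⟨,⟩_{p,ℚ} := [K:ℚ]⁻¹ ⟨,⟩^{Sch}_{p,K}` where `K` denotes any Galois extension of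
`ℚ` such that `E` is semistable at all places above `p` and `⟨,⟩^{Sch}_{p,K} : E(K) × E(K) → ℚ_p` is
Schneider's `p`-adic height pairing [Sn1]." That is: the `p`-adic height of a curve `W/ℚ` ADDITIVE at
`p` is DEFINED by transporting a height datum over `K` back to `W(ℚ)` and dividing by the degree. In
the cell's (S8)/(S9) files (`Summits/…/Additive/XGordRankOneZeroCyclotomicThreeLowerK*.lean`,
seat n1011-p16) the transport is an additive map `Tr : W(ℚ) →+ V(K)` onto the base change of the
twist partner `V` (`C • V^{(d)} = W`, `K = ℚ(√d)`; `exists_twistTransport`), and the typed Schneider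
input `hS1K` carries the clause `∀ P P', DK.pairing (Tr P) (Tr P') = 2 * Dh.pairing P P'` relating
Schneider's `K`-datum `DK` to the `ℚ`-datum `Dh` of `W`. With THIS definition,
`Dh := DK.transportDiv Tr [K:ℚ]`, that clause holds BY CONSTRUCTION (`mul_transportDiv_pairing`,
`pairing_eq_two_mul_transportDiv_of_finrank_eq_two`) — it is Delbourgo's normalisation, not a
theorem to be cited; what remains a genuine INPUT is Schneider's leading-term display for `V_K`
(Greenberg LNM 1716 §4 p. 110; the tree's reading-fact
`Greenberg1999.schneider_charCoeff_rankOne_quadraticBaseChange`) together with whatever PINS the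
datum `DK` (a `p`-adic Gross–Zagier input at `Dh`, or a canonicity predicate): a bare
"`∃ DK`, display" is vacuous in rank one (the value `DK(Q,Q)` of an abstract datum is unconstrained),
exactly the vacuity flag of `PAdicHeights.lean` / `Delbourgo2002/PAdicBSDLeadingTerm.lean`.

Contents: `PAdicHeightDataK.transportDiv DK Φ c : PAdicHeightData W p` (pairing
`(c : ℚ_p)⁻¹ · DK(Φ P, Φ Q)`; symmetric; kills torsion because `Φ` preserves finite order),
`transportDiv_pairing`, `mul_transportDiv_pairing`, `pairing_eq_mul_transportDiv`, and the quadratic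
specialisation `delbourgoHeight DK Φ := DK.transportDiv Φ (finrank ℚ K)` with
`pairing_eq_two_mul_delbourgoHeight` (`[K:ℚ] = 2`). Mathlib generality: any `V W : WeierstrassCurve ℚ`,
any number field `K`, any additive `Φ`, any `c : ℕ`.

References: [Delbourgo2002] D. Delbourgo, J. Number Theory 95 (2002) 38–71, p. 39; [Schneider1985];
[GreenbergLNM1716] §4 p. 110; Mazur–Tate 1983 / [BalakrishnanBesserBianchiMuller2021] §2.2, §5
(functoriality and the degree factor for heights of a base change — context only, nothing used).
-/

set_option autoImplicit false

noncomputable section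

open scoped Classical

namespace WeierstrassCurve.PAdicHeightDataK

variable {V W : WeierstrassCurve ℚ} {p : ℕ} [Fact p.Prime] {K : Type} [Field K] [NumberField K]
  (DK : PAdicHeightDataK V p K) (Φ : W.toAffine.Point →+ (V.baseChange K).toAffine.Point)

/-- **Delbourgo's normalised transport of a `K`-height datum** (J. Number Theory 95 (2002) p. 39:
`⟨,⟩_{p,ℚ} := [K:ℚ]⁻¹⟨,⟩^{Sch}_{p,K}`), along an additive map `Φ : W(ℚ) →+ V(K)` and with divisor `c`:
the `ℚ`-height datum on `W(ℚ)` with pairing `(P, Q) ↦ c⁻¹ · DK(Φ P, Φ Q)` — symmetric, bilinear,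
vanishing on torsion (`Φ` preserves finite order). For `Φ` = the twisting transport `W(ℚ) → V(K)`
(`W ≅ V^{(d)}`, `K = ℚ(√d)`) and `c = [K:ℚ]` this is Delbourgo's height of the additive curve `W`.
[cite: Delbourgo2002, p. 39 (definition of ⟨,⟩_{p,ℚ}; held copy chunk p0002 L40–48)] -/
def transportDiv (c : ℕ) : PAdicHeightData W p where
  pairing := AddMonoidHom.mk' (fun P ↦ (c : ℚ_[p])⁻¹ • (DK.pairing (Φ P)).comp Φ) fun P P' ↦ by
    ext Q
    simp only [map_add, AddMonoidHom.add_comp, smul_add, AddMonoidHom.add_apply]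
  symm P Q := by
    simp only [AddMonoidHom.mk'_apply, AddMonoidHom.smul_apply, AddMonoidHom.coe_comp,
      Function.comp_apply, DK.symm (Φ P) (Φ Q)]
  map_torsion P Q hP := by
    simp only [AddMonoidHom.mk'_apply, AddMonoidHom.smul_apply, AddMonoidHom.coe_comp,
      Function.comp_apply, DK.map_torsion (Φ P) (Φ Q) (Φ.isOfFinAddOrder hP), smul_zero]

/-- Unfolding: `(DK.transportDiv Φ c)(P, Q) = c⁻¹ · DK(Φ P, Φ Q)`. [cite: Delbourgo2002, p. 39] -/
@[simp] theorem transportDiv_pairing (c : ℕ) (P Q : W.toAffine.Point) :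
    (DK.transportDiv Φ c).pairing P Q = (c : ℚ_[p])⁻¹ * DK.pairing (Φ P) (Φ Q) := by
  simp [transportDiv]

/-- `c · ⟨P, Q⟩_{transportDiv} = DK(Φ P, Φ Q)` for `c ≠ 0`. [cite: Delbourgo2002, p. 39] -/
theorem mul_transportDiv_pairing {c : ℕ} (hc : c ≠ 0) (P Q : W.toAffine.Point) :
    (c : ℚ_[p]) * (DK.transportDiv Φ c).pairing P Q = DK.pairing (Φ P) (Φ Q) := by
  have hc' : (c : ℚ_[p]) ≠ 0 := by exact_mod_cast hc
  rw [transportDiv_pairing, ← mul_assoc, mul_inv_cancel₀ hc', one_mul]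

/-- **The restriction clause, by construction:** `DK(Φ P, Φ Q) = c · ⟨P, Q⟩` for the transported
datum — the shape `PAdicHeightDataK.RestrictsToWith` has for the inclusion `E(ℚ) ⊂ E(K)`, here along
an arbitrary additive `Φ`. [cite: Delbourgo2002, p. 39] -/
theorem pairing_eq_mul_transportDiv {c : ℕ} (hc : c ≠ 0) (P Q : W.toAffine.Point) :
    DK.pairing (Φ P) (Φ Q) = (c : ℚ_[p]) * (DK.transportDiv Φ c).pairing P Q :=
  (DK.mul_transportDiv_pairing Φ hc P Q).symm

/-- **Delbourgo's height of `W` through `K`**: `transportDiv` with the printed divisor `c = [K:ℚ]`.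
[cite: Delbourgo2002, p. 39] -/
def delbourgoHeight : PAdicHeightData W p :=
  DK.transportDiv Φ (Module.finrank ℚ K)

/-- Unfolding: `⟨P, Q⟩_{p,ℚ} = [K:ℚ]⁻¹ · DK(Φ P, Φ Q)`. [cite: Delbourgo2002, p. 39] -/
theorem delbourgoHeight_pairing (P Q : W.toAffine.Point) :
    (DK.delbourgoHeight Φ).pairing P Q =
      ((Module.finrank ℚ K : ℕ) : ℚ_[p])⁻¹ * DK.pairing (Φ P) (Φ Q) :=
  DK.transportDiv_pairing Φ _ P Q

/-- **Quadratic `K`: `DK(Φ P, Φ Q) = 2 · ⟨P, Q⟩_{p,ℚ}`** — the clause of the cell's typed Schneider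
input `hS1K` (`XGordRankOneZeroCyclotomicThreeLowerK.lean`) holds by construction for
`Dh := DK.delbourgoHeight Tr`. [cite: Delbourgo2002, p. 39] -/
theorem pairing_eq_two_mul_delbourgoHeight (h2 : Module.finrank ℚ K = 2) (P Q : W.toAffine.Point) :
    DK.pairing (Φ P) (Φ Q) = 2 * (DK.delbourgoHeight Φ).pairing P Q := by
  rw [delbourgoHeight_pairing, h2, Nat.cast_ofNat, ← mul_assoc, mul_inv_cancel₀ two_ne_zero, one_mul]

/-- The restriction clause in the cell's binder form: `∀ P P', DK(Tr P, Tr P') = 2 · Dh(P, P')` with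
`Dh := DK.delbourgoHeight Tr`, `[K:ℚ] = 2`. [cite: Delbourgo2002, p. 39] -/
theorem forall_pairing_eq_two_mul_delbourgoHeight (h2 : Module.finrank ℚ K = 2) :
    ∀ P P' : W.toAffine.Point, DK.pairing (Φ P) (Φ P') = 2 * (DK.delbourgoHeight Φ).pairing P P' :=
  DK.pairing_eq_two_mul_delbourgoHeight Φ h2

end WeierstrassCurve.PAdicHeightDataK

end
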